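import Literature.AlgebraicGeometry.HodgeTheory.FermatHodgeCharacterLocal
import HarnessLib

/-!
# Fourier split of the odd part of a function on `(ℤ/qn)ˣ` (stub of line `cancel-by-any-claim-lattice`)

Crux `HodgeFermatVarieties` (stmt-HodgeConjecture-1334), line `cancel-by-any-claim-lattice`, level-`5q`
programme, stub `stub_oddPart_split_of_orthogonal` (lead c3). Aoki's character criterion at conductor
`5q` says that the indicator `F` of the unit entries of a Hodge multiset of `ℤ/5q` is orthogonal to
every ODD character `χ₁ ⊠ χ₂` mod `5q` with BOTH components non-trivial. This file proves the
abstract Fourier consequence, for any coprime `q, n ≥ 1` and any `F : ℤ/(qn) → ℂ` with that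
orthogonality: the odd part `o(x) = F(x) - F(-x)` is, on units, the sum of an odd function of
`x mod n` and an odd function of `x mod q`:
`F(x) - F(-x) = G(x mod n) + H(x mod q)` for all units `x` of `ℤ/(qn)`.

Proof (elementary Fourier analysis on the finite abelian group `(ℤ/qn)ˣ ≅ (ℤ/q)ˣ × (ℤ/n)ˣ`).
With a CRT lift `ℓ(a, b)` of pairs of units (`FermatCharacter.exists_unit_crt`), put
`S(x) = ∑_{a ∈ (ℤ/q)ˣ} o(ℓ(a,1)·x)` (sum of `o` over the coset of `x` modulo the kernel of
reduction mod `n`) and `T(x) = ∑_{b ∈ (ℤ/n)ˣ} o(ℓ(1,b)·x)`. For a character `χ = χ₁ ⊠ χ₂` mod `qn`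
(every character is such a product, `FermatCharacter.exists_eq_prodChar`):
`⟨S, χ⟩ = (∑_a χ₁(a⁻¹)) ⟨o, χ⟩ = φ(q)·[χ₁ = 1]·⟨o, χ⟩` and `⟨T, χ⟩ = φ(n)·[χ₂ = 1]·⟨o, χ⟩`, while
`⟨o, χ⟩ = 0` when `χ` is even (oddness of `o`) or odd with `χ₁ ≠ 1 ≠ χ₂` (hypothesis); a four-case
check shows `D = o - S/φ(q) - T/φ(n)` is orthogonal to every `χ`, hence vanishes on units by
Fourier inversion (`FermatCharacter.totient_mul_apply_eq_sum_char`). Finally `S(x)` depends only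
on `x mod n` and `T(x)` only on `x mod q` for units `x` (re-indexing the fibre sums), and both
slices of `(a, b) ↦ o(ℓ(a, b))` are odd because `o` is and `ℓ(-a, -b) = -ℓ(a, b)`.

Everything here is proved (no named facts, no definitions: the lift `ℓ` is a hypothesis of the
lemmas, produced by `choose` in the final theorem); the only import is the proved toolkit
`Literature.AlgebraicGeometry.HodgeTheory.FermatHodgeCharacterLocal`.

References: [Aoki1983] N. Aoki, On some arithmetic problems related to the Hodge cycles on the
Fermat varieties, Math. Ann. 266 (1983) 23–54, §3 (the character criterion whose output this file
post-processes); the Fourier analysis itself is folklore.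
-/

set_option linter.dupNamespace false

noncomputable section

open Finset
open Literature.AlgebraicGeometry.HodgeTheory Literature.AlgebraicGeometry.HodgeTheory.FermatCharacter

namespace Summit.HodgeConjecture.HodgeConjecture.Theorems.CancelByAnyClaimLattice.FiveQ

namespace FourierSplit

/-! ### Character sums at one level -/

section OneLevel

variable {m : ℕ}

/-- Reduction of units commutes with negation. [folklore] -/
theorem unitsMap_neg {d : ℕ} (hd : d ∣ m) (k : (ZMod m)ˣ) :
    ZMod.unitsMap hd (-k) = -ZMod.unitsMap hd k := by
  rw [ZMod.unitsMap_def]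
  exact Units.map_neg _ _

variable [NeZero m]

/-- Twisting a character sum by a unit `k`: `∑ₓ g(kx) χ(x) = χ(k⁻¹) ∑ₓ g(x) χ(x)`. [folklore] -/
theorem sum_unit_mul_mul_char (g : ZMod m → ℂ) (χ : DirichletCharacter ℂ m) (k : (ZMod m)ˣ) :
    ∑ x : ZMod m, g ((k : ZMod m) * x) * χ x =
      χ ((k⁻¹ : (ZMod m)ˣ) : ZMod m) * ∑ x : ZMod m, g x * χ x := by
  rw [Finset.mul_sum,
    ← (Units.mulLeft_bijective k⁻¹).sum_comp (fun x ↦ g ((k : ZMod m) * x) * χ x)]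
  refine Finset.sum_congr rfl fun x _ ↦ ?_
  simp only [Units.mul_inv_cancel_left, map_mul]
  ring

/-- The sum of an ODD function against an EVEN character vanishes. [folklore] -/
theorem sum_mul_char_eq_zero_of_odd_of_even (o : ZMod m → ℂ) (ho : ∀ x, o (-x) = -o x)
    (χ : DirichletCharacter ℂ m) (hχ : χ (-1) = 1) : ∑ x : ZMod m, o x * χ x = 0 := by
  have key := sum_neg_mul_char o χ
  rw [hχ, one_mul] at key
  have h2 : ∑ x : ZMod m, o (-x) * χ x = -∑ x : ZMod m, o x * χ x := by
    rw [← Finset.sum_neg_distrib]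
    exact Finset.sum_congr rfl fun x _ ↦ by rw [ho, neg_mul]
  rw [h2] at key
  linear_combination (-(1 : ℂ) / 2) * key

/-- Orthogonality on the unit group: `∑_{a ∈ (ℤ/m)ˣ} χ(a⁻¹) = 0` for `χ ≠ 1`. [folklore] -/
theorem sum_units_char_inv_eq_zero {χ : DirichletCharacter ℂ m} (hχ : χ ≠ 1) :
    ∑ a : (ZMod m)ˣ, χ ((a⁻¹ : (ZMod m)ˣ) : ZMod m) = 0 := by
  have h1 : ∑ a : (ZMod m)ˣ, χ ((a⁻¹ : (ZMod m)ˣ) : ZMod m) = ∑ a : (ZMod m)ˣ, χ (a : ZMod m) :=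
    Fintype.sum_equiv (Equiv.inv (ZMod m)ˣ) _ _ (fun _ ↦ rfl)
  rw [h1]
  set f : (ZMod m)ˣ →* ℂ := (Units.coeHom ℂ).comp (MulChar.toUnitHom χ) with hf
  have hf1 : f ≠ 1 := by
    intro h1
    apply hχ
    rw [MulChar.eq_one_iff]
    intro a
    have := DFunLike.congr_fun h1 a
    rw [MonoidHom.one_apply, hf, MonoidHom.comp_apply, Units.coeHom_apply,
      MulChar.coe_toUnitHom] at this
    exact_mod_cast this
  have key := sum_hom_units_eq_zero f hf1
  simpa only [hf, MonoidHom.comp_apply, Units.coeHom_apply, MulChar.coe_toUnitHom] using key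

/-- `∑_{a ∈ (ℤ/m)ˣ} 1(a⁻¹) = φ(m)` for the trivial character. [folklore] -/
theorem sum_units_one_inv :
    ∑ a : (ZMod m)ˣ, (1 : DirichletCharacter ℂ m) ((a⁻¹ : (ZMod m)ˣ) : ZMod m) = (m.totient : ℂ) := by
  simp only [MulChar.one_apply_coe, Finset.sum_const, Finset.card_univ, ZMod.card_units_eq_totient,
    nsmul_eq_mul, mul_one]

end OneLevel

/-! ### Two coprime levels: CRT lifts of units -/

section CRT

variable {q n : ℕ}

/-- A unit of `ℤ/(qn)` (`q, n` coprime) is determined by its reductions mod `q` and mod `n`.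
[folklore] -/
theorem units_eq_of_unitsMap_eq (h : q.Coprime n) {x y : (ZMod (q * n))ˣ}
    (h1 : ZMod.unitsMap (dvd_mul_right q n) x = ZMod.unitsMap (dvd_mul_right q n) y)
    (h2 : ZMod.unitsMap (dvd_mul_left n q) x = ZMod.unitsMap (dvd_mul_left n q) y) : x = y := by
  ext
  refine eq_of_cast_eq_of_coprime h ?_ ?_
  · rw [← coe_unitsMap, ← coe_unitsMap, h1]
  · rw [← coe_unitsMap, ← coe_unitsMap, h2]

variable (h : q.Coprime n) (ℓ : (ZMod q)ˣ → (ZMod n)ˣ → (ZMod (q * n))ˣ)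
  (hℓ₁ : ∀ a b, ZMod.unitsMap (dvd_mul_right q n) (ℓ a b) = a)
  (hℓ₂ : ∀ a b, ZMod.unitsMap (dvd_mul_left n q) (ℓ a b) = b)
include h hℓ₁ hℓ₂

/-- Characterisation of a CRT lift `ℓ` of pairs of units (`ℓ(a,b) ≡ a (q)`, `≡ b (n)`) by the two
reductions. [folklore] -/
theorem eq_lift_of_unitsMap_eq {x : (ZMod (q * n))ˣ} {a : (ZMod q)ˣ} {b : (ZMod n)ˣ}
    (h1 : ZMod.unitsMap (dvd_mul_right q n) x = a) (h2 : ZMod.unitsMap (dvd_mul_left n q) x = b) :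
    x = ℓ a b :=
  units_eq_of_unitsMap_eq h (by rw [h1, hℓ₁]) (by rw [h2, hℓ₂])

/-- `ℓ(a, 1) · w = ℓ(a · (w mod q), w mod n)`. [folklore] -/
theorem lift_one_mul (a : (ZMod q)ˣ) (w : (ZMod (q * n))ˣ) :
    ℓ a 1 * w = ℓ (a * ZMod.unitsMap (dvd_mul_right q n) w) (ZMod.unitsMap (dvd_mul_left n q) w) :=
  eq_lift_of_unitsMap_eq h ℓ hℓ₁ hℓ₂ (by rw [map_mul, hℓ₁]) (by rw [map_mul, hℓ₂, one_mul])

/-- `ℓ(1, b) · w = ℓ(w mod q, b · (w mod n))`. [folklore] -/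
theorem lift_mul_one (b : (ZMod n)ˣ) (w : (ZMod (q * n))ˣ) :
    ℓ 1 b * w = ℓ (ZMod.unitsMap (dvd_mul_right q n) w) (b * ZMod.unitsMap (dvd_mul_left n q) w) :=
  eq_lift_of_unitsMap_eq h ℓ hℓ₁ hℓ₂ (by rw [map_mul, hℓ₁, one_mul]) (by rw [map_mul, hℓ₂])

/-- `ℓ(-a, -b) = -ℓ(a, b)`. [folklore] -/
theorem lift_neg_neg (a : (ZMod q)ˣ) (b : (ZMod n)ˣ) : -ℓ a b = ℓ (-a) (-b) :=
  eq_lift_of_unitsMap_eq h ℓ hℓ₁ hℓ₂ (by rw [unitsMap_neg, hℓ₁]) (by rw [unitsMap_neg, hℓ₂])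

/-- For an odd `o`, `o(ℓ(-a, -b)) = -o(ℓ(a, b))`. [folklore] -/
theorem apply_lift_neg_neg (o : ZMod (q * n) → ℂ) (ho : ∀ x, o (-x) = -o x) (a : (ZMod q)ˣ)
    (b : (ZMod n)ˣ) :
    o ((ℓ (-a) (-b) : (ZMod (q * n))ˣ) : ZMod (q * n)) = -o ((ℓ a b : (ZMod (q * n))ˣ) : ZMod (q * n)) := by
  rw [← lift_neg_neg h ℓ hℓ₁ hℓ₂, Units.val_neg, ho]

end CRT

/-! ### Two coprime levels: fibre sums and their Fourier coefficients -/

section TwoLevels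

variable {q n : ℕ} [NeZero q] [NeZero n] (h : q.Coprime n)
  (ℓ : (ZMod q)ˣ → (ZMod n)ˣ → (ZMod (q * n))ˣ)
  (hℓ₁ : ∀ a b, ZMod.unitsMap (dvd_mul_right q n) (ℓ a b) = a)
  (hℓ₂ : ∀ a b, ZMod.unitsMap (dvd_mul_left n q) (ℓ a b) = b)
include hℓ₁ hℓ₂

/-- The product character `χ₁ ⊠ χ₂` at `ℓ(a, b)⁻¹` is `χ₁(a⁻¹) χ₂(b⁻¹)`. [folklore] -/
theorem prodChar_lift_inv (χ₁ : DirichletCharacter ℂ q) (χ₂ : DirichletCharacter ℂ n)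
    (a : (ZMod q)ˣ) (b : (ZMod n)ˣ) :
    (DirichletCharacter.changeLevel (dvd_mul_right q n) χ₁ *
        DirichletCharacter.changeLevel (dvd_mul_left n q) χ₂)
        (((ℓ a b)⁻¹ : (ZMod (q * n))ˣ) : ZMod (q * n)) =
      χ₁ ((a⁻¹ : (ZMod q)ˣ) : ZMod q) * χ₂ ((b⁻¹ : (ZMod n)ˣ) : ZMod n) := by
  rw [prodChar_apply, ← coe_unitsMap (dvd_mul_right q n) (ℓ a b)⁻¹,
    ← coe_unitsMap (dvd_mul_left n q) (ℓ a b)⁻¹, map_inv, map_inv, hℓ₁, hℓ₂]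

/-- **Fourier coefficients of the left fibre sum**: for `S(x) = ∑_a o(ℓ(a,1)·x)`,
`⟨S, χ₁ ⊠ χ₂⟩ = (∑_a χ₁(a⁻¹)) · ⟨o, χ₁ ⊠ χ₂⟩`. [folklore] -/
theorem sum_fibreLeft_mul_prodChar (o : ZMod (q * n) → ℂ) (χ₁ : DirichletCharacter ℂ q)
    (χ₂ : DirichletCharacter ℂ n) :
    ∑ x : ZMod (q * n), (∑ a : (ZMod q)ˣ, o (((ℓ a 1 : (ZMod (q * n))ˣ) : ZMod (q * n)) * x)) *
        (DirichletCharacter.changeLevel (dvd_mul_right q n) χ₁ *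
          DirichletCharacter.changeLevel (dvd_mul_left n q) χ₂) x =
      (∑ a : (ZMod q)ˣ, χ₁ ((a⁻¹ : (ZMod q)ˣ) : ZMod q)) *
        ∑ x : ZMod (q * n), o x * (DirichletCharacter.changeLevel (dvd_mul_right q n) χ₁ *
          DirichletCharacter.changeLevel (dvd_mul_left n q) χ₂) x := by
  simp_rw [Finset.sum_mul]
  rw [Finset.sum_comm]
  refine Finset.sum_congr rfl fun a _ ↦ ?_
  rw [sum_unit_mul_mul_char, prodChar_lift_inv ℓ hℓ₁ hℓ₂, inv_one, Units.val_one, map_one,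
    mul_one]

/-- **Fourier coefficients of the right fibre sum**: for `T(x) = ∑_b o(ℓ(1,b)·x)`,
`⟨T, χ₁ ⊠ χ₂⟩ = (∑_b χ₂(b⁻¹)) · ⟨o, χ₁ ⊠ χ₂⟩`. [folklore] -/
theorem sum_fibreRight_mul_prodChar (o : ZMod (q * n) → ℂ) (χ₁ : DirichletCharacter ℂ q)
    (χ₂ : DirichletCharacter ℂ n) :
    ∑ x : ZMod (q * n), (∑ b : (ZMod n)ˣ, o (((ℓ 1 b : (ZMod (q * n))ˣ) : ZMod (q * n)) * x)) *
        (DirichletCharacter.changeLevel (dvd_mul_right q n) χ₁ *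
          DirichletCharacter.changeLevel (dvd_mul_left n q) χ₂) x =
      (∑ b : (ZMod n)ˣ, χ₂ ((b⁻¹ : (ZMod n)ˣ) : ZMod n)) *
        ∑ x : ZMod (q * n), o x * (DirichletCharacter.changeLevel (dvd_mul_right q n) χ₁ *
          DirichletCharacter.changeLevel (dvd_mul_left n q) χ₂) x := by
  simp_rw [Finset.sum_mul]
  rw [Finset.sum_comm]
  refine Finset.sum_congr rfl fun b _ ↦ ?_
  rw [sum_unit_mul_mul_char, prodChar_lift_inv ℓ hℓ₁ hℓ₂, inv_one, Units.val_one, map_one,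
    one_mul]

include h

/-- **The defect is orthogonal to every character.** If `o` is odd and orthogonal to every odd
product character with both components non-trivial, then
`D = o - S/φ(q) - T/φ(n)` satisfies `⟨D, χ⟩ = 0` for every character `χ` mod `qn`. [folklore] -/
theorem sum_defect_mul_char_eq_zero (o : ZMod (q * n) → ℂ) (ho : ∀ x, o (-x) = -o x)
    (horth : ∀ (χ₁ : DirichletCharacter ℂ q) (χ₂ : DirichletCharacter ℂ n), χ₁ ≠ 1 → χ₂ ≠ 1 →
      (DirichletCharacter.changeLevel (dvd_mul_right q n) χ₁ *
        DirichletCharacter.changeLevel (dvd_mul_left n q) χ₂) (-1) = -1 →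
      ∑ x : ZMod (q * n), o x * (DirichletCharacter.changeLevel (dvd_mul_right q n) χ₁ *
        DirichletCharacter.changeLevel (dvd_mul_left n q) χ₂) x = 0)
    (χ : DirichletCharacter ℂ (q * n)) :
    ∑ x : ZMod (q * n), (o x -
        ((q.totient : ℂ))⁻¹ * ∑ a : (ZMod q)ˣ, o (((ℓ a 1 : (ZMod (q * n))ˣ) : ZMod (q * n)) * x) -
        ((n.totient : ℂ))⁻¹ * ∑ b : (ZMod n)ˣ, o (((ℓ 1 b : (ZMod (q * n))ˣ) : ZMod (q * n)) * x)) *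
      χ x = 0 := by
  obtain ⟨χ₁, χ₂, rfl, -⟩ := exists_eq_prodChar h χ
  have hq : (q.totient : ℂ) ≠ 0 := by exact_mod_cast (Nat.totient_pos.mpr (NeZero.pos q)).ne'
  have hn : (n.totient : ℂ) ≠ 0 := by exact_mod_cast (Nat.totient_pos.mpr (NeZero.pos n)).ne'
  have hsplit : ∀ (c A B C : ℂ),
      (A - ((q.totient : ℂ))⁻¹ * B - ((n.totient : ℂ))⁻¹ * C) * c =
        A * c - ((q.totient : ℂ))⁻¹ * (B * c) - ((n.totient : ℂ))⁻¹ * (C * c) := by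
    intros; ring
  simp_rw [hsplit]
  rw [Finset.sum_sub_distrib, Finset.sum_sub_distrib, ← Finset.mul_sum, ← Finset.mul_sum,
    sum_fibreLeft_mul_prodChar ℓ hℓ₁ hℓ₂, sum_fibreRight_mul_prodChar ℓ hℓ₁ hℓ₂]
  set Ω := ∑ x : ZMod (q * n), o x * (DirichletCharacter.changeLevel (dvd_mul_right q n) χ₁ *
    DirichletCharacter.changeLevel (dvd_mul_left n q) χ₂) x with hΩ
  rcases eq_or_ne χ₁ 1 with rfl | h1 <;> rcases eq_or_ne χ₂ 1 with rfl | h2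
  · -- both trivial: the product is even, so `Ω = 0`
    have heven : (DirichletCharacter.changeLevel (dvd_mul_right q n) (1 : DirichletCharacter ℂ q) *
        DirichletCharacter.changeLevel (dvd_mul_left n q) (1 : DirichletCharacter ℂ n)) (-1) = 1 := by
      rw [prodChar_neg_one, MulChar.one_apply isUnit_one.neg, MulChar.one_apply isUnit_one.neg,
        mul_one]
    rw [hΩ, sum_mul_char_eq_zero_of_odd_of_even o ho _ heven]
    ring
  · rw [sum_units_one_inv, sum_units_char_inv_eq_zero h2]
    field_simp
    ring
  · rw [sum_units_one_inv, sum_units_char_inv_eq_zero h1]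
    field_simp
    ring
  · rw [sum_units_char_inv_eq_zero h1, sum_units_char_inv_eq_zero h2]
    rcases char_neg_one_eq_or (DirichletCharacter.changeLevel (dvd_mul_right q n) χ₁ *
        DirichletCharacter.changeLevel (dvd_mul_left n q) χ₂) with he | hodd
    · rw [hΩ, sum_mul_char_eq_zero_of_odd_of_even o ho _ he]
      ring
    · rw [hΩ, horth χ₁ χ₂ h1 h2 hodd]
      ring

/-- **The defect vanishes on units** (Fourier inversion): under the hypotheses of
`sum_defect_mul_char_eq_zero`, `o(w) = S(w)/φ(q) + T(w)/φ(n)` for every unit `w`. [folklore] -/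
theorem apply_eq_fibreSums (o : ZMod (q * n) → ℂ) (ho : ∀ x, o (-x) = -o x)
    (horth : ∀ (χ₁ : DirichletCharacter ℂ q) (χ₂ : DirichletCharacter ℂ n), χ₁ ≠ 1 → χ₂ ≠ 1 →
      (DirichletCharacter.changeLevel (dvd_mul_right q n) χ₁ *
        DirichletCharacter.changeLevel (dvd_mul_left n q) χ₂) (-1) = -1 →
      ∑ x : ZMod (q * n), o x * (DirichletCharacter.changeLevel (dvd_mul_right q n) χ₁ *
        DirichletCharacter.changeLevel (dvd_mul_left n q) χ₂) x = 0)
    (w : (ZMod (q * n))ˣ) :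
    o w = ((q.totient : ℂ))⁻¹ * ∑ a : (ZMod q)ˣ, o (((ℓ a 1 : (ZMod (q * n))ˣ) : ZMod (q * n)) * w) +
      ((n.totient : ℂ))⁻¹ * ∑ b : (ZMod n)ˣ, o (((ℓ 1 b : (ZMod (q * n))ˣ) : ZMod (q * n)) * w) := by
  have key := totient_mul_apply_eq_sum_char (fun x ↦ o x -
    ((q.totient : ℂ))⁻¹ * ∑ a : (ZMod q)ˣ, o (((ℓ a 1 : (ZMod (q * n))ˣ) : ZMod (q * n)) * x) -
    ((n.totient : ℂ))⁻¹ * ∑ b : (ZMod n)ˣ, o (((ℓ 1 b : (ZMod (q * n))ˣ) : ZMod (q * n)) * x)) w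
  simp only [sum_defect_mul_char_eq_zero h ℓ hℓ₁ hℓ₂ o ho horth, mul_zero,
    Finset.sum_const_zero] at key
  have hN : ((q * n).totient : ℂ) ≠ 0 := by
    exact_mod_cast (Nat.totient_pos.mpr (NeZero.pos (q * n))).ne'
  have h0 := (mul_eq_zero.mp key).resolve_left hN
  linear_combination h0

omit [NeZero n] in
/-- The left fibre sum at a unit `w` depends only on `w mod n`:
`∑_a o(ℓ(a,1)·w) = ∑_a o(ℓ(a, w mod n))`. [folklore] -/
theorem fibreLeft_coe (o : ZMod (q * n) → ℂ) (w : (ZMod (q * n))ˣ) :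
    ∑ a : (ZMod q)ˣ, o (((ℓ a 1 : (ZMod (q * n))ˣ) : ZMod (q * n)) * w) =
      ∑ a : (ZMod q)ˣ, o ((ℓ a (ZMod.unitsMap (dvd_mul_left n q) w) : (ZMod (q * n))ˣ) : ZMod (q * n)) := by
  calc ∑ a : (ZMod q)ˣ, o (((ℓ a 1 : (ZMod (q * n))ˣ) : ZMod (q * n)) * w)
      = ∑ a : (ZMod q)ˣ, o ((ℓ (a * ZMod.unitsMap (dvd_mul_right q n) w)
          (ZMod.unitsMap (dvd_mul_left n q) w) : (ZMod (q * n))ˣ) : ZMod (q * n)) := by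
        refine Finset.sum_congr rfl fun a _ ↦ ?_
        rw [← Units.val_mul, lift_one_mul h ℓ hℓ₁ hℓ₂]
    _ = ∑ a : (ZMod q)ˣ, o ((ℓ a (ZMod.unitsMap (dvd_mul_left n q) w) : (ZMod (q * n))ˣ) : ZMod (q * n)) :=
        (Group.mulRight_bijective (ZMod.unitsMap (dvd_mul_right q n) w)).sum_comp
          (fun a ↦ o ((ℓ a (ZMod.unitsMap (dvd_mul_left n q) w) : (ZMod (q * n))ˣ) : ZMod (q * n)))

omit [NeZero q] in
/-- The right fibre sum at a unit `w` depends only on `w mod q`: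
`∑_b o(ℓ(1,b)·w) = ∑_b o(ℓ(w mod q, b))`. [folklore] -/
theorem fibreRight_coe (o : ZMod (q * n) → ℂ) (w : (ZMod (q * n))ˣ) :
    ∑ b : (ZMod n)ˣ, o (((ℓ 1 b : (ZMod (q * n))ˣ) : ZMod (q * n)) * w) =
      ∑ b : (ZMod n)ˣ, o ((ℓ (ZMod.unitsMap (dvd_mul_right q n) w) b : (ZMod (q * n))ˣ) : ZMod (q * n)) := by
  calc ∑ b : (ZMod n)ˣ, o (((ℓ 1 b : (ZMod (q * n))ˣ) : ZMod (q * n)) * w)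
      = ∑ b : (ZMod n)ˣ, o ((ℓ (ZMod.unitsMap (dvd_mul_right q n) w)
          (b * ZMod.unitsMap (dvd_mul_left n q) w) : (ZMod (q * n))ˣ) : ZMod (q * n)) := by
        refine Finset.sum_congr rfl fun b _ ↦ ?_
        rw [← Units.val_mul, lift_mul_one h ℓ hℓ₁ hℓ₂]
    _ = ∑ b : (ZMod n)ˣ, o ((ℓ (ZMod.unitsMap (dvd_mul_right q n) w) b : (ZMod (q * n))ˣ) : ZMod (q * n)) :=
        (Group.mulRight_bijective (ZMod.unitsMap (dvd_mul_left n q) w)).sum_comp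
          (fun b ↦ o ((ℓ (ZMod.unitsMap (dvd_mul_right q n) w) b : (ZMod (q * n))ˣ) : ZMod (q * n)))

end TwoLevels

end FourierSplit

/-! ### The stub -/

/-- **Fourier split of the odd part** (stub `stub_oddPart_split_of_orthogonal` of line
`cancel-by-any-claim-lattice`). Let `q, n ≥ 1` be coprime and `F : ℤ/(qn) → ℂ` be orthogonal to
every odd character `χ₁ ⊠ χ₂` mod `qn` with `χ₁ ≠ 1` and `χ₂ ≠ 1`. Then there are odd functions
`G` on `(ℤ/n)ˣ` and `H` on `(ℤ/q)ˣ` with `F(x) - F(-x) = G(x mod n) + H(x mod q)` for every unit `x`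
of `ℤ/(qn)`: explicitly `G(b) = φ(q)⁻¹ ∑_a o(ℓ(a,b))`, `H(a) = φ(n)⁻¹ ∑_b o(ℓ(a,b))` for the odd part
`o` and a CRT lift `ℓ` of pairs of units. [folklore] -/
theorem stub_oddPart_split_of_orthogonal :
    ∀ (q n : ℕ) [NeZero q] [NeZero n], q.Coprime n → ∀ F : ZMod (q * n) → ℂ,
      (∀ (χ₁ : DirichletCharacter ℂ q) (χ₂ : DirichletCharacter ℂ n), χ₁ ≠ 1 → χ₂ ≠ 1 →
        (DirichletCharacter.changeLevel (dvd_mul_right q n) χ₁ * DirichletCharacter.changeLevel (dvd_mul_left n q) χ₂) (-1) = -1 →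
        ∑ x : ZMod (q * n), F x * (DirichletCharacter.changeLevel (dvd_mul_right q n) χ₁ * DirichletCharacter.changeLevel (dvd_mul_left n q) χ₂) x = 0) →
      ∃ (G : (ZMod n)ˣ → ℂ) (H : (ZMod q)ˣ → ℂ),
        (∀ b : (ZMod n)ˣ, G (-b) = -G b) ∧ (∀ a : (ZMod q)ˣ, H (-a) = -H a) ∧
        ∀ x : (ZMod (q * n))ˣ, F (x : ZMod (q * n)) - F (-(x : ZMod (q * n))) =
          G (ZMod.unitsMap (dvd_mul_left n q) x) + H (ZMod.unitsMap (dvd_mul_right q n) x) := by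
  intro q n _ _ h F hF
  -- a CRT lift of pairs of units
  choose ℓ hℓ₁ hℓ₂ using fun (a : (ZMod q)ˣ) (b : (ZMod n)ˣ) ↦ exists_unit_crt h a b
  -- the odd part and its orthogonality
  set o : ZMod (q * n) → ℂ := fun x ↦ F x - F (-x) with ho_def
  have ho : ∀ x, o (-x) = -o x := fun x ↦ by simp only [ho_def, neg_neg, neg_sub]
  have horth : ∀ (χ₁ : DirichletCharacter ℂ q) (χ₂ : DirichletCharacter ℂ n), χ₁ ≠ 1 → χ₂ ≠ 1 →
      (DirichletCharacter.changeLevel (dvd_mul_right q n) χ₁ *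
        DirichletCharacter.changeLevel (dvd_mul_left n q) χ₂) (-1) = -1 →
      ∑ x : ZMod (q * n), o x * (DirichletCharacter.changeLevel (dvd_mul_right q n) χ₁ *
        DirichletCharacter.changeLevel (dvd_mul_left n q) χ₂) x = 0 := by
    intro χ₁ χ₂ h1 h2 hodd
    have key := sum_neg_mul_char F (DirichletCharacter.changeLevel (dvd_mul_right q n) χ₁ *
        DirichletCharacter.changeLevel (dvd_mul_left n q) χ₂)
    rw [hodd, hF χ₁ χ₂ h1 h2 hodd, mul_zero] at key
    simp only [ho_def, sub_mul, Finset.sum_sub_distrib, hF χ₁ χ₂ h1 h2 hodd, key, sub_zero]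
  refine ⟨fun b ↦ ((q.totient : ℂ))⁻¹ * ∑ a : (ZMod q)ˣ, o ((ℓ a b : (ZMod (q * n))ˣ) : ZMod (q * n)),
    fun a ↦ ((n.totient : ℂ))⁻¹ * ∑ b : (ZMod n)ˣ, o ((ℓ a b : (ZMod (q * n))ˣ) : ZMod (q * n)),
    fun b ↦ ?_, fun a ↦ ?_, fun x ↦ ?_⟩
  · -- `G` is odd: re-index `a ↦ -a`
    rw [← mul_neg, ← Finset.sum_neg_distrib]
    refine congrArg _ (Fintype.sum_equiv (Equiv.neg (ZMod q)ˣ) _ _ fun a ↦ ?_)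
    rw [Equiv.neg_apply, ← FourierSplit.apply_lift_neg_neg h ℓ hℓ₁ hℓ₂ o ho, neg_neg]
  · -- `H` is odd: re-index `b ↦ -b`
    rw [← mul_neg, ← Finset.sum_neg_distrib]
    refine congrArg _ (Fintype.sum_equiv (Equiv.neg (ZMod n)ˣ) _ _ fun b ↦ ?_)
    rw [Equiv.neg_apply, ← FourierSplit.apply_lift_neg_neg h ℓ hℓ₁ hℓ₂ o ho, neg_neg]
  · have key := FourierSplit.apply_eq_fibreSums h ℓ hℓ₁ hℓ₂ o ho horth x
    rw [FourierSplit.fibreLeft_coe h ℓ hℓ₁ hℓ₂ o x, FourierSplit.fibreRight_coe h ℓ hℓ₁ hℓ₂ o x] at key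
    exact key

end Summit.HodgeConjecture.HodgeConjecture.Theorems.CancelByAnyClaimLattice.FiveQ

end
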